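import Mathlib
import Literature.MathematicalPhysics.KineticTheory.HardSphereEulerProofs
import HarnessLib

/-!
# `StaticScoreResponse` (support item stmt-AtomisticToContinuum-12269): the local Gibbs measure in
# Gaussian coordinates

The local Gibbs measure of `N + 1` hard spheres (`localGibbsMeasure σ a₀ u₀ θ₀ N`, the flow-free
form of `localGibbsLaw`) is the image of the product of

* the configurational canonical Gibbs measure `posGibbsMeasure a₀ ε_N (N+1)` on the positions, and
* the product of `N + 1` standard Gaussians on `ℝ³`,

under the map `(x, w) ↦ (xᵢ, u₀(xᵢ) + √θ₀(xᵢ) wᵢ)ᵢ` (`localGibbsMeasure_eq_map`): conditionally on the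
positions the velocities are independent Maxwellians `N(u₀(xᵢ), θ₀(xᵢ))`
(`lintegral_localGibbsMeasure` of `HardSphereEulerProofs`, `velMeasure_eq_map`). Consequently
(`integral_localGibbsMeasure_eq`) every integrable observable disintegrates as
`∫ G dP_N = ∫ (∫ G(x, u₀(x) + √θ₀(x) w) dγ^{⊗(N+1)}(w)) d(posGibbsMeasure)(x)` — the Bochner form used
to reduce covariances with the score to configurational ones in the proof of `StaticScoreResponse`.
Folklore; no definitions, no named facts.
-/

noncomputable section

namespace Summit.AtomisticToContinuum.HydrodynamicLimit.Theorems

open MeasureTheory ProbabilityTheory Set Filter Topology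
  Literature.Analysis.FluidPDE Literature.MathematicalPhysics.KineticTheory
open scoped ENNReal

variable {a₀ θ₀ : T3 → ℝ} {u₀ : T3 → V3}

/-- **The velocity law in Gaussian coordinates**: `⊗ᵢ N(u₀(xᵢ), θ₀(xᵢ))` is the image of
`⊗ᵢ N(0, 1)` under `w ↦ (u₀(xᵢ) + √θ₀(xᵢ) wᵢ)ᵢ`. [folklore] -/
theorem velMeasure_eq_map (u₀ : T3 → V3) (θ₀ : T3 → ℝ) {n : ℕ} (x : Fin n → T3) :
    velMeasure u₀ θ₀ x = (Measure.pi fun _ : Fin n => stdGaussian V3).map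
      (fun w i => u₀ (x i) + Real.sqrt (θ₀ (x i)) • w i) := by
  have h := measurePreserving_pi (fun _ : Fin n => stdGaussian V3) (fun i => gaussMeasure (u₀ (x i)) (θ₀ (x i)))
    (f := fun i w => u₀ (x i) + Real.sqrt (θ₀ (x i)) • w) fun i => ⟨measurable_gaussShift _ _, rfl⟩
  exact h.map_eq.symm

/-- The Gaussian parametrisation of phase space is measurable. [folklore] -/
theorem measurable_gaussParam (hθ : Continuous θ₀) (hu : Continuous u₀) (n : ℕ) :
    Measurable fun p : (Fin n → T3) × (Fin n → V3) =>
      zipConfig (p.1, fun i => u₀ (p.1 i) + Real.sqrt (θ₀ (p.1 i)) • p.2 i) := by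
  refine measurable_zipConfig.comp (measurable_fst.prodMk ?_)
  refine measurable_pi_lambda _ fun i => ?_
  exact ((hu.measurable.comp ((measurable_pi_apply i).comp measurable_fst)).add
    (((Real.continuous_sqrt.measurable.comp (hθ.measurable.comp ((measurable_pi_apply i).comp measurable_fst)))).smul
      ((measurable_pi_apply i).comp measurable_snd)))

/-- For fixed positions the Gaussian parametrisation of the velocities is measurable. [folklore] -/
theorem measurable_gaussParam_right (u₀ : T3 → V3) (θ₀ : T3 → ℝ) {n : ℕ} (x : Fin n → T3) :
    Measurable fun w : Fin n → V3 => zipConfig (x, fun i => u₀ (x i) + Real.sqrt (θ₀ (x i)) • w i) := by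
  refine measurable_zipConfig.comp (measurable_const.prodMk ?_)
  exact measurable_pi_lambda _ fun i => by fun_prop

/-- The configurational Gibbs measure of a continuous nonnegative activity is a finite measure.
[folklore] -/
theorem isFiniteMeasure_posGibbsMeasure (ha : Continuous a₀) (ha0 : ∀ x, 0 ≤ a₀ x) (ε : ℝ) (n : ℕ) :
    IsFiniteMeasure (posGibbsMeasure a₀ ε n) := by
  unfold posGibbsMeasure
  exact isFiniteMeasure_withDensity_ofReal ((integrable_posWeight ha ha0 ε n).const_mul _).2

/-- **The local Gibbs measure in Gaussian coordinates.** For continuous profiles `a₀ ≥ 0`, `θ₀ > 0`,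
`u₀`: `localGibbsMeasure σ a₀ u₀ θ₀ N` is the image of
`posGibbsMeasure a₀ ε_N (N+1) ⊗ γ^{⊗(N+1)}` under `(x, w) ↦ (xᵢ, u₀(xᵢ) + √θ₀(xᵢ) wᵢ)ᵢ`. [folklore] -/
theorem localGibbsMeasure_eq_map (ha : Continuous a₀) (hθ : Continuous θ₀) (hu : Continuous u₀)
    (ha0 : ∀ x, 0 ≤ a₀ x) (hθ0 : ∀ x, 0 < θ₀ x) (σ : ℝ) (N : ℕ) :
    localGibbsMeasure σ a₀ u₀ θ₀ N =
      ((posGibbsMeasure a₀ (hsDiameter σ N) (N + 1)).prod (Measure.pi fun _ : Fin (N + 1) => stdGaussian V3)).map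
        (fun p : (Fin (N + 1) → T3) × (Fin (N + 1) → V3) =>
          zipConfig (p.1, fun i => u₀ (p.1 i) + Real.sqrt (θ₀ (p.1 i)) • p.2 i)) := by
  set ε := hsDiameter σ N with hε
  set n := N + 1 with hn
  haveI := isFiniteMeasure_posGibbsMeasure ha ha0 ε n
  have hT := measurable_gaussParam hθ hu n (u₀ := u₀)
  refine Measure.ext fun A hA => ?_
  -- both sides as integrals of the indicator
  have hind : Measurable (A.indicator (1 : Literature.Analysis.FluidPDE.Config n (Fin 3) T3 → ℝ≥0∞)) :=
    measurable_one.indicator hA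
  rw [← lintegral_indicator_one hA, lintegral_localGibbsMeasure ha hθ hu ha0 hθ0 σ N hind,
    Measure.map_apply hT hA, ← lintegral_indicator_one (hT hA), canonicalPartition_eq_posPartition ha hθ hu ha0 hθ0]
  have hind' : Measurable fun p : (Fin n → T3) × (Fin n → V3) =>
      A.indicator (1 : Literature.Analysis.FluidPDE.Config n (Fin 3) T3 → ℝ≥0∞)
        (zipConfig (p.1, fun i => u₀ (p.1 i) + Real.sqrt (θ₀ (p.1 i)) • p.2 i)) := hind.comp hT
  have hindT : ∀ p : (Fin n → T3) × (Fin n → V3),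
      ((fun p : (Fin n → T3) × (Fin n → V3) => zipConfig (p.1, fun i => u₀ (p.1 i) + Real.sqrt (θ₀ (p.1 i)) • p.2 i)) ⁻¹' A).indicator
        (1 : (Fin n → T3) × (Fin n → V3) → ℝ≥0∞) p =
      A.indicator 1 (zipConfig (p.1, fun i => u₀ (p.1 i) + Real.sqrt (θ₀ (p.1 i)) • p.2 i)) := fun p => rfl
  simp_rw [hindT]
  have hdens : Measurable fun x : Fin n → T3 => ENNReal.ofReal ((posPartition a₀ ε n)⁻¹ * posWeight a₀ ε n x) :=
    (measurable_const.mul (measurable_posWeight ha ε n)).ennreal_ofReal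
  rw [lintegral_prod _ hind'.aemeasurable, posGibbsMeasure, lintegral_withDensity_eq_lintegral_mul _ hdens
    (hind'.lintegral_prod_right')]
  refine lintegral_congr fun x => ?_
  dsimp only [Pi.mul_apply]
  congr 1
  have hshift : Measurable fun w : Fin n → V3 => fun i => u₀ (x i) + Real.sqrt (θ₀ (x i)) • w i :=
    measurable_pi_lambda _ fun i => by fun_prop
  have hzip : Measurable fun v : Fin n → V3 => A.indicator (1 : Literature.Analysis.FluidPDE.Config n (Fin 3) T3 → ℝ≥0∞)
      (zipConfig (x, v)) := hind.comp (measurable_zipConfig.comp (measurable_const.prodMk measurable_id))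
  rw [velMeasure_eq_map, lintegral_map hzip hshift]

/-- **Disintegration of the local Gibbs measure (Bochner form).** For an integrable observable `G`:
`∫ G dP_N = ∫ (∫ G(x, u₀(x) + √θ₀(x) w) dγ^{⊗(N+1)}(w)) d(posGibbsMeasure a₀ ε_N (N+1))(x)`.
[folklore] -/
theorem integral_localGibbsMeasure_eq (ha : Continuous a₀) (hθ : Continuous θ₀) (hu : Continuous u₀)
    (ha0 : ∀ x, 0 ≤ a₀ x) (hθ0 : ∀ x, 0 < θ₀ x) (σ : ℝ) (N : ℕ)
    {G : Literature.Analysis.FluidPDE.Config (N + 1) (Fin 3) T3 → ℝ} (hG : Integrable G (localGibbsMeasure σ a₀ u₀ θ₀ N)) :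
    ∫ z, G z ∂localGibbsMeasure σ a₀ u₀ θ₀ N =
      ∫ x, (∫ w, G (zipConfig (x, fun i => u₀ (x i) + Real.sqrt (θ₀ (x i)) • w i))
        ∂Measure.pi fun _ : Fin (N + 1) => stdGaussian V3) ∂posGibbsMeasure a₀ (hsDiameter σ N) (N + 1) := by
  haveI := isFiniteMeasure_posGibbsMeasure ha ha0 (hsDiameter σ N) (N + 1)
  have hT := measurable_gaussParam hθ hu (N + 1) (u₀ := u₀)
  rw [localGibbsMeasure_eq_map ha hθ hu ha0 hθ0 σ N] at hG ⊢
  rw [integral_map hT.aemeasurable hG.aestronglyMeasurable]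
  have hG' : Integrable (fun p : (Fin (N + 1) → T3) × (Fin (N + 1) → V3) =>
      G (zipConfig (p.1, fun i => u₀ (p.1 i) + Real.sqrt (θ₀ (p.1 i)) • p.2 i)))
      ((posGibbsMeasure a₀ (hsDiameter σ N) (N + 1)).prod (Measure.pi fun _ : Fin (N + 1) => stdGaussian V3)) :=
    (integrable_map_measure hG.aestronglyMeasurable hT.aemeasurable).1 hG
  rw [integral_prod _ hG']

end Summit.AtomisticToContinuum.HydrodynamicLimit.Theorems

end
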